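/-
Copyright (c) 2026 the pub-hodgecm-mathlib formalisation cell (harness21).  Prover seat hodgecm-mathlib-F0P2-p11 (g2) (L1; LEAD F0P6-plan (g14) «(o1) KIND 1», memo
`CENSUS-K1-DealTable` brick (T4-α) part 2), Track B «K2-LIT» ∕ hLiu418 #184♮, ROAD Φ, G5-b: THE UNIPOTENT RADICAL AND THE UNIPOTENT CHARACTERS ALONG THE DOUBLED
BLOCK-DIAGONAL EMBEDDING `blkD` — `N_Δ(V₂) ↪ N_Δ(V₁ ⊕ V₂)` and `ψ_S ∘ blkD (1, ·) = ψ_{S₂₂}`.  THEOREMS ONLY.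
-/
import Literature.NumberTheory.K2Lit.SiegelDoubledUnipotent                                 -- ★ `unipDelta`, `mem_unipDelta_iff_blocks`, `blk_one`
import Literature.NumberTheory.GelbartRogawski1991.DoubledBlockDiagEmbeddingDelta           -- ★ `blkD`, `blk_blkD_toBlocks··`, `deltaBlock_blkD`, `isSiegelDelta_blkD`
import Summits.HodgeConjecture.HodgeConjecture.Theorems.K2LiuSiegelUnipotentFourierDefs     -- ★ `unipDeltaChar`
import HarnessLib

/-!
# Crux `HLiu418`, KIND 1, brick (T4-α) part 2: `blkD (1, ·)` carries `N_Δ(V₂)(𝔸)` into `N_Δ(V₁ ⊕ V₂)(𝔸)` with corner block `0 ⊕ X`, and the unipotent character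
# `ψ_S` of `H(V)` restricts along it to the unipotent character `ψ_{S₂₂}` of `H(V₂)`, `S₂₂ =` the `V₂`-corner of `S` (symmetrically for `blkD (·, 1)`)

Cell `hodgecm-mathlib`, crux item hLiu418 = `stmt-HodgeConjecture-24832` (helper lane, count-neutral); squad K2 ∕ K2Liu, LEAD F0P6-plan (g14); prover F0P2-p11 (g2).
THEOREMS ONLY (no `def`, no `instance`, no notation, no named-fact hypothesis, no `sorry`).  GENERIC in `V = V₁ ⊕ V₂` (no rank hypothesis).

Sequel of ★ `K2LiuBlockDiagSectionPullback` (p862495: Siegel sections pull back along ★ `blkD` with the modulus shift).  Here the UNIPOTENT side of the corner chart: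
* §0 matrix devices: the trace is invariant under re-enumeration (`trace_submatrix_equiv`) and additive over a block decomposition (`trace_fromBlocks'`); `reindex` of block sums.
* §1 **`blk_blkD_one_inr_toBlocks₁₂`** — the corner coordinate of `blkD (1, y)` is `σ⁻¹-reindex (0 ⊕ X(y))`, `X(y) = (blk y)₁₂`; **`blkD_one_inr_mem_unipDelta`** —
  `y ∈ N_Δ(V₂)(𝔸) ⇒ blkD (1, y) ∈ N_Δ(V)(𝔸)` (★ `mem_unipDelta_iff_blocks`: Siegel ★ `isSiegelDelta_blkD`, `h|_Δ = 1` ★ `deltaBlock_blkD`, `h₂₂ − h₁₂ = 1` blockwise);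
  the `inl` twins `blk_blkD_inl_one_toBlocks₁₂`, `blkD_inl_one_mem_unipDelta`.
* §2 **`unipDeltaChar_blkD_one_inr`** — `ψ^{(V)}_S (blkD (1, y)) = ψ^{(V₂)}_{S₂₂} (y)` for EVERY `y ∈ H(V₂)(𝔸)` and every index `S ∈ M_n(L)`, with
  `S₂₂ := (reindex σ σ S).toBlocks₂₂` (`σ = idxSplit`): `tr(S · σ⁻¹(0 ⊕ X)) = tr(σ(S) · (0 ⊕ X)) = tr(S₂₂ · X)`; the `inl` twin `unipDeltaChar_blkD_inl_one` with `S₁₁`.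
USE (memo `CENSUS-K1-DealTable` (T4-α)∕(T4-β)): at `N₁ = N₂ = M = 1` the corner line `n₂(t)` of ★ p861153∕p861327 is `blkD (1, n⁽¹⁾ t)` (§1 pins its corner coordinate; `N_Δ` elements
are determined by it) and the transported character `ψ_S(Λĝ⁻¹ · Λĝ)` restricted to the corner line is the rank-one character `ψ⁽¹⁾_{μ_S}` of the doubled LINE (§2) — the
two identifications (T4-β) needs besides ★ p862495 and the Weyl element `w₀ = blkD (1, w_Δ⁽¹⁾)` (next file).
HONEST LABEL.  Count-neutral helper; `HC_CM` is proved only modulo the 7 printed citations (2 remaining named inputs: hLiu418 = `stmt-HodgeConjecture-24832`,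
h413 = `stmt-HodgeConjecture-24833`) until rung 0 closes.

## References
* [Kudla1994] S. Kudla, *Splitting metaplectic covers of dual reductive pairs*, Israel J. Math. 87 (1994), §2, Thm. 3.1.
* [KudlaRallis1994] S. Kudla, S. Rallis, Ann. of Math. 140 (1994), §2 (singular coefficients through lower-rank doubled groups).
* [Shimura1997] G. Shimura, *Euler products and Eisenstein series*, CBMS 93 (1997), §18.1 (18.4) (the characters `ψ(tr(βn(b)))`).
* [MoeglinWaldspurger1995] C. Mœglin, J.-L. Waldspurger, CUP (1995), I.2.1, I.2.6.
-/

set_option autoImplicit false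
set_option linter.dupNamespace false -- the mandated namespace repeats `HodgeConjecture.HodgeConjecture`

noncomputable section

open scoped Matrix
open NumberField IsDedekindDomain
open Literature.NumberTheory.Automorphic Literature.NumberTheory.GaloisRepresentations
open Literature.NumberTheory.GelbartRogawski1991 Literature.NumberTheory.GelbartRogawski1991.GRConstruction
open Literature.NumberTheory.K2Lit.SiegelDoubled

namespace Summit.HodgeConjecture.HodgeConjecture.Cruxes.HLiu418.K2LiuBlockDiagUnipotentChart

open K2LiuSiegelUnipotentFourierDefs

/-! ## §0 Matrix devices -/

section Devices

/-- the trace is invariant under re-enumeration of the index type. [folklore] -/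
theorem trace_submatrix_equiv {R : Type*} [AddCommMonoid R] {ι l : Type*} [Fintype ι] [Fintype l] (A : Matrix ι ι R) (σ : l ≃ ι) :
    Matrix.trace (A.submatrix σ σ) = Matrix.trace A := by
  simp only [Matrix.trace, Matrix.diag, Matrix.submatrix_apply]
  exact σ.sum_comp (fun j => A j j)

/-- the trace of a block matrix is the sum of the traces of its diagonal blocks. [folklore] -/
theorem trace_fromBlocks' {R : Type*} [AddCommMonoid R] {κ₁ κ₂ : Type*} [Fintype κ₁] [Fintype κ₂]
    (A : Matrix κ₁ κ₁ R) (B : Matrix κ₁ κ₂ R) (C : Matrix κ₂ κ₁ R) (D : Matrix κ₂ κ₂ R) :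
    Matrix.trace (Matrix.fromBlocks A B C D) = Matrix.trace A + Matrix.trace D := by
  simp only [Matrix.trace, Matrix.diag, Fintype.sum_sum_type, Matrix.fromBlocks_apply₁₁, Matrix.fromBlocks_apply₂₂]

/-- **`tr(S · σ⁻¹(0 ⊕ X)) = tr(S₂₂ · X)`**, `S₂₂ = (σ S)₂₂`: the trace pairing of an index `S` with a corner-supported coordinate sees only the corner block of `S`.
[cite: Shimura1997, §18.1 (18.4)] -/
theorem trace_mul_reindex_symm_fromBlocks_zero {R : Type*} [CommRing R] {ι κ₁ κ₂ : Type*} [Fintype ι] [Fintype κ₁] [Fintype κ₂]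
    (σ : ι ≃ κ₁ ⊕ κ₂) (S : Matrix ι ι R) (X : Matrix κ₂ κ₂ R) :
    Matrix.trace (S * Matrix.reindex σ.symm σ.symm (Matrix.fromBlocks 0 0 0 X)) =
      Matrix.trace ((Matrix.reindex σ σ S).toBlocks₂₂ * X) := by
  have h1 : S * Matrix.reindex σ.symm σ.symm (Matrix.fromBlocks 0 0 0 X) =
      (Matrix.reindex σ σ S * Matrix.fromBlocks 0 0 0 X).submatrix σ σ := by
    rw [Matrix.reindex_apply, Matrix.reindex_apply, Equiv.symm_symm, ← Matrix.submatrix_mul_equiv _ _ σ σ σ,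
      Matrix.submatrix_submatrix, Equiv.symm_comp_self, Matrix.submatrix_id_id]
  rw [h1, trace_submatrix_equiv, ← Matrix.fromBlocks_toBlocks (Matrix.reindex σ σ S), Matrix.fromBlocks_multiply, trace_fromBlocks',
    Matrix.fromBlocks_toBlocks]
  simp

/-- the `inl` twin: `tr(S · σ⁻¹(X ⊕ 0)) = tr(S₁₁ · X)`, `S₁₁ = (σ S)₁₁`. [cite: Shimura1997, §18.1 (18.4)] -/
theorem trace_mul_reindex_symm_fromBlocks_zero' {R : Type*} [CommRing R] {ι κ₁ κ₂ : Type*} [Fintype ι] [Fintype κ₁] [Fintype κ₂]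
    (σ : ι ≃ κ₁ ⊕ κ₂) (S : Matrix ι ι R) (X : Matrix κ₁ κ₁ R) :
    Matrix.trace (S * Matrix.reindex σ.symm σ.symm (Matrix.fromBlocks X 0 0 0)) =
      Matrix.trace ((Matrix.reindex σ σ S).toBlocks₁₁ * X) := by
  have h1 : S * Matrix.reindex σ.symm σ.symm (Matrix.fromBlocks X 0 0 0) =
      (Matrix.reindex σ σ S * Matrix.fromBlocks X 0 0 0).submatrix σ σ := by
    rw [Matrix.reindex_apply, Matrix.reindex_apply, Equiv.symm_symm, ← Matrix.submatrix_mul_equiv _ _ σ σ σ,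
      Matrix.submatrix_submatrix, Equiv.symm_comp_self, Matrix.submatrix_id_id]
  rw [h1, trace_submatrix_equiv, ← Matrix.fromBlocks_toBlocks (Matrix.reindex σ σ S), Matrix.fromBlocks_multiply, trace_fromBlocks',
    Matrix.fromBlocks_toBlocks]
  simp

/-- `σ⁻¹(1 ⊕ 1) = 1`. [folklore] -/
theorem reindex_symm_fromBlocks_one {R : Type*} [Zero R] [One R] {ι κ₁ κ₂ : Type*} [DecidableEq ι] [DecidableEq κ₁] [DecidableEq κ₂]
    (σ : ι ≃ κ₁ ⊕ κ₂) :
    Matrix.reindex σ.symm σ.symm (Matrix.fromBlocks (1 : Matrix κ₁ κ₁ R) 0 0 (1 : Matrix κ₂ κ₂ R)) = 1 := by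
  rw [Matrix.fromBlocks_one, Matrix.reindex_apply, Equiv.symm_symm, Matrix.submatrix_one_equiv]

/-- `σ⁻¹`-reindex of block sums is additive blockwise (subtraction form). [folklore] -/
theorem reindex_symm_fromBlocks_sub {R : Type*} [AddGroup R] {ι κ₁ κ₂ : Type*} (σ : ι ≃ κ₁ ⊕ κ₂)
    (A A' : Matrix κ₁ κ₁ R) (B B' : Matrix κ₁ κ₂ R) (C C' : Matrix κ₂ κ₁ R) (D D' : Matrix κ₂ κ₂ R) :
    Matrix.reindex σ.symm σ.symm (Matrix.fromBlocks A B C D) - Matrix.reindex σ.symm σ.symm (Matrix.fromBlocks A' B' C' D') =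
      Matrix.reindex σ.symm σ.symm (Matrix.fromBlocks (A - A') (B - B') (C - C') (D - D')) := by
  ext i j
  simp only [Matrix.reindex_apply, Matrix.sub_apply, Matrix.submatrix_apply, Equiv.symm_symm]
  rcases σ i with a | a <;> rcases σ j with b | b <;>
    simp [Matrix.fromBlocks_apply₁₁, Matrix.fromBlocks_apply₁₂, Matrix.fromBlocks_apply₂₁, Matrix.fromBlocks_apply₂₂]

end Devices

/-! ## §1 `blkD (1, ·)` and `blkD (·, 1)` on the unipotent radicals -/

variable (L : Type) [Field L] [NumberField L] [IsCMField L]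
variable {N₁ N₂ M n n₁ n₂ : ℕ} (eV : Fin (N₁ + N₂) × Fin M ≃ Fin n) (eA : Fin N₁ × Fin M ≃ Fin n₁) (eB : Fin N₂ × Fin M ≃ Fin n₂)
  (dA : Fin N₁ → L) (hdA : ∀ i, IsCMField.complexConj L (dA i) = dA i)
  (dB : Fin N₂ → L) (hdB : ∀ i, IsCMField.complexConj L (dB i) = dB i)
  (dV : Fin (N₁ + N₂) → L) (hdV : ∀ i, IsCMField.complexConj L (dV i) = dV i)
  (hVA : ∀ i, dV (Fin.castAdd N₂ i) = dA i) (hVB : ∀ j, dV (Fin.natAdd N₁ j) = dB j)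
  (dW : Fin M → L) (hdW : ∀ i, IsCMField.complexConj L (dW i) = dW i)

section Blocks

variable {K : Type} [Field K] [NumberField K] [IsCMField K] {N' M' n' : ℕ} (e' : Fin N' × Fin M' ≃ Fin n')
  (d' : Fin N' → K) (hd' : ∀ i, IsCMField.complexConj K (d' i) = d' i) (dW' : Fin M' → K) (hdW' : ∀ i, IsCMField.complexConj K (dW' i) = dW' i)

/-- the four doubling blocks of `1 ∈ H(𝔸)`: `1, 0, 0, 1` (★ `blk_one`). [cite: Kudla1994, §2] -/
theorem blk_one_toBlocks :
    (blk K e' d' hd' dW' hdW' 1).toBlocks₁₁ = 1 ∧ (blk K e' d' hd' dW' hdW' 1).toBlocks₁₂ = 0 ∧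
      (blk K e' d' hd' dW' hdW' 1).toBlocks₂₁ = 0 ∧ (blk K e' d' hd' dW' hdW' 1).toBlocks₂₂ = 1 := by
  rw [blk_one, ← Matrix.fromBlocks_one, Matrix.toBlocks_fromBlocks₁₁, Matrix.toBlocks_fromBlocks₁₂, Matrix.toBlocks_fromBlocks₂₁,
    Matrix.toBlocks_fromBlocks₂₂]
  exact ⟨rfl, rfl, rfl, rfl⟩

end Blocks

/-- **the corner coordinate of `blkD (1, y)` is `σ⁻¹(0 ⊕ X(y))`**, `X(y) = (blk y)₁₂`. [cite: Kudla1994, §2] -/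
theorem blk_blkD_one_inr_toBlocks₁₂ (y : HA L eB dB hdB dW hdW) :
    (blk L eV dV hdV dW hdW (blkD L eV eA eB dA hdA dB hdB dV hdV hVA hVB dW hdW (1, y))).toBlocks₁₂ =
      Matrix.reindex (idxSplit eV eA eB).symm (idxSplit eV eA eB).symm (Matrix.fromBlocks 0 0 0 (blk L eB dB hdB dW hdW y).toBlocks₁₂) := by
  rw [blk_blkD_toBlocks₁₂, (blk_one_toBlocks eA dA hdA dW hdW).2.1]

/-- the `inl` twin: the corner coordinate of `blkD (x, 1)` is `σ⁻¹(X(x) ⊕ 0)`. [cite: Kudla1994, §2] -/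
theorem blk_blkD_inl_one_toBlocks₁₂ (x : HA L eA dA hdA dW hdW) :
    (blk L eV dV hdV dW hdW (blkD L eV eA eB dA hdA dB hdB dV hdV hVA hVB dW hdW (x, 1))).toBlocks₁₂ =
      Matrix.reindex (idxSplit eV eA eB).symm (idxSplit eV eA eB).symm (Matrix.fromBlocks (blk L eA dA hdA dW hdW x).toBlocks₁₂ 0 0 0) := by
  rw [blk_blkD_toBlocks₁₂, (blk_one_toBlocks eB dB hdB dW hdW).2.1]

/-- **`N_Δ(V₂)(𝔸) ↪ N_Δ(V₁ ⊕ V₂)(𝔸)` along `y ↦ blkD (1, y)`** (★ `mem_unipDelta_iff_blocks`: Siegel by ★ `isSiegelDelta_blkD`, `h|_Δ = 1` by ★ `deltaBlock_blkD`,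
`h₂₂ − h₁₂ = 1` blockwise by ★ `blk_blkD_toBlocks₂₂∕₁₂`). [cite: MoeglinWaldspurger1995, I.2.1] [cite: Kudla1994, §2] -/
theorem blkD_one_inr_mem_unipDelta {y : HA L eB dB hdB dW hdW} (hy : y ∈ unipDelta L eB dB hdB dW hdW) :
    blkD L eV eA eB dA hdA dB hdB dV hdV hVA hVB dW hdW (1, y) ∈ unipDelta L eV dV hdV dW hdW := by
  have h1 := blk_one_toBlocks eA dA hdA dW hdW
  rw [mem_unipDelta_iff_blocks] at hy ⊢
  obtain ⟨hyS, hyΔ, hy3⟩ := hy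
  refine ⟨isSiegelDelta_blkD L eV eA eB dA hdA dB hdB dV hdV hVA hVB dW hdW (isSiegelDelta_one' L eA dA hdA dW hdW) hyS, ?_, ?_⟩
  · rw [deltaBlock_blkD, deltaBlock_eq_one_of_mem_unipDelta L eA dA hdA dW hdW (Subgroup.one_mem _)]
    show Matrix.reindex (idxSplit eV eA eB).symm (idxSplit eV eA eB).symm (Matrix.fromBlocks 1 0 0 (deltaBlock L eB dB hdB dW hdW y)) = 1
    rw [hyΔ, reindex_symm_fromBlocks_one]
  · rw [blk_blkD_toBlocks₂₂, blk_blkD_toBlocks₁₂, h1.2.1, h1.2.2.2]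
    show Matrix.reindex (idxSplit eV eA eB).symm (idxSplit eV eA eB).symm (Matrix.fromBlocks 1 0 0 (blk L eB dB hdB dW hdW y).toBlocks₂₂) -
        Matrix.reindex (idxSplit eV eA eB).symm (idxSplit eV eA eB).symm (Matrix.fromBlocks 0 0 0 (blk L eB dB hdB dW hdW y).toBlocks₁₂) = 1
    rw [reindex_symm_fromBlocks_sub, hy3]
    simp only [sub_zero]
    exact reindex_symm_fromBlocks_one _

/-- the `inl` twin: **`N_Δ(V₁)(𝔸) ↪ N_Δ(V₁ ⊕ V₂)(𝔸)` along `x ↦ blkD (x, 1)`**. [cite: MoeglinWaldspurger1995, I.2.1] [cite: Kudla1994, §2] -/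
theorem blkD_inl_one_mem_unipDelta {x : HA L eA dA hdA dW hdW} (hx : x ∈ unipDelta L eA dA hdA dW hdW) :
    blkD L eV eA eB dA hdA dB hdB dV hdV hVA hVB dW hdW (x, 1) ∈ unipDelta L eV dV hdV dW hdW := by
  have h1 := blk_one_toBlocks eB dB hdB dW hdW
  rw [mem_unipDelta_iff_blocks] at hx ⊢
  obtain ⟨hxS, hxΔ, hx3⟩ := hx
  refine ⟨isSiegelDelta_blkD L eV eA eB dA hdA dB hdB dV hdV hVA hVB dW hdW hxS (isSiegelDelta_one' L eB dB hdB dW hdW), ?_, ?_⟩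
  · rw [deltaBlock_blkD, deltaBlock_eq_one_of_mem_unipDelta L eB dB hdB dW hdW (Subgroup.one_mem _)]
    show Matrix.reindex (idxSplit eV eA eB).symm (idxSplit eV eA eB).symm (Matrix.fromBlocks (deltaBlock L eA dA hdA dW hdW x) 0 0 1) = 1
    rw [hxΔ, reindex_symm_fromBlocks_one]
  · rw [blk_blkD_toBlocks₂₂, blk_blkD_toBlocks₁₂, h1.2.1, h1.2.2.2]
    show Matrix.reindex (idxSplit eV eA eB).symm (idxSplit eV eA eB).symm (Matrix.fromBlocks (blk L eA dA hdA dW hdW x).toBlocks₂₂ 0 0 1) -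
        Matrix.reindex (idxSplit eV eA eB).symm (idxSplit eV eA eB).symm (Matrix.fromBlocks (blk L eA dA hdA dW hdW x).toBlocks₁₂ 0 0 0) = 1
    rw [reindex_symm_fromBlocks_sub, hx3]
    simp only [sub_zero]
    exact reindex_symm_fromBlocks_one _

/-! ## §2 The unipotent characters along `blkD (1, ·)` and `blkD (·, 1)` -/

/-- **`ψ^{(V)}_S (blkD (1, y)) = ψ^{(V₂)}_{S₂₂}(y)`** for every `y ∈ H(V₂)(𝔸)` and every index `S ∈ M_n(L)`, `S₂₂ := (reindex σ σ S).toBlocks₂₂` the `V₂`-corner of `S`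
(`ψ_S(u) = ψ_L(tr(S_𝔸 · X(u)))` ★ `unipDeltaChar_apply`; §1 and `tr(S · σ⁻¹(0 ⊕ X)) = tr(S₂₂ · X)`). [cite: Shimura1997, §18.1 (18.4)] [cite: KudlaRallis1994, §2] -/
theorem unipDeltaChar_blkD_one_inr (S : Matrix (Fin n) (Fin n) L) (y : HA L eB dB hdB dW hdW) :
    unipDeltaChar L eV dV hdV dW hdW S (blkD L eV eA eB dA hdA dB hdB dV hdV hVA hVB dW hdW (1, y)) =
      unipDeltaChar L eB dB hdB dW hdW ((Matrix.reindex (idxSplit eV eA eB) (idxSplit eV eA eB) S).toBlocks₂₂) y := by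
  have hmap : (Matrix.reindex (idxSplit eV eA eB) (idxSplit eV eA eB) (S.map (algebraMap L (AdeleRing (𝓞 L) L)))).toBlocks₂₂ =
      ((Matrix.reindex (idxSplit eV eA eB) (idxSplit eV eA eB) S).toBlocks₂₂).map (algebraMap L (AdeleRing (𝓞 L) L)) := by
    ext i j
    rfl
  rw [unipDeltaChar_apply, unipDeltaChar_apply, blk_blkD_one_inr_toBlocks₁₂, trace_mul_reindex_symm_fromBlocks_zero, hmap]

/-- the `inl` twin: **`ψ^{(V)}_S (blkD (x, 1)) = ψ^{(V₁)}_{S₁₁}(x)`**, `S₁₁ := (reindex σ σ S).toBlocks₁₁`. [cite: Shimura1997, §18.1 (18.4)] [cite: KudlaRallis1994, §2] -/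
theorem unipDeltaChar_blkD_inl_one (S : Matrix (Fin n) (Fin n) L) (x : HA L eA dA hdA dW hdW) :
    unipDeltaChar L eV dV hdV dW hdW S (blkD L eV eA eB dA hdA dB hdB dV hdV hVA hVB dW hdW (x, 1)) =
      unipDeltaChar L eA dA hdA dW hdW ((Matrix.reindex (idxSplit eV eA eB) (idxSplit eV eA eB) S).toBlocks₁₁) x := by
  have hmap : (Matrix.reindex (idxSplit eV eA eB) (idxSplit eV eA eB) (S.map (algebraMap L (AdeleRing (𝓞 L) L)))).toBlocks₁₁ =
      ((Matrix.reindex (idxSplit eV eA eB) (idxSplit eV eA eB) S).toBlocks₁₁).map (algebraMap L (AdeleRing (𝓞 L) L)) := by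
    ext i j
    rfl
  rw [unipDeltaChar_apply, unipDeltaChar_apply, blk_blkD_inl_one_toBlocks₁₂, trace_mul_reindex_symm_fromBlocks_zero', hmap]

end Summit.HodgeConjecture.HodgeConjecture.Cruxes.HLiu418.K2LiuBlockDiagUnipotentChart

end
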